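import Summits.QuantumFields.YangMills.Theorems.BalabanUVNodesN12FlatFibreNullSpace
import Summits.QuantumFields.YangMills.Theorems.BalabanUVNodesN12FlatChartDerivIterLin
import Literature.MathematicalPhysics.QuantumFieldTheory.Balaban1983to89.Node00.WilsonActionSecondVariationNearFlat
import Literature.MathematicalPhysics.QuantumFieldTheory.Balaban1983to89.B11Eq177CriticalFamilyDerivative
import HarnessLib

/-!
# BalabanUVNodes ∕ N12 — (β)♭ AT NODE 00's OBJECTS: THE NONDEGENERACY LETTER `hnd` OF THE FLAT MULTI-SCALE CHART, MODULO THE SLICE LETTER — a direction in a transversal gauge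
# slice which is killed by the derivative of n07-w2's canonical chart `msChart` at the flat configuration AND along which the flat second variation of the Wilson action vanishes is
# ZERO; packaged as the `hnd` binder of the U2b theorem for the gauge-fixed chart `X ↦ (Φ X, G X)` — [Balaban1989LargeFieldII] p. 359 «P₀H*_{1,k}Δ₁H_{1,k}P₀ is positive, hence
# invertible on this subspace», read at `U₀ = 1`, qualitatively

Cell `pub-ymgap` (HUMAN RULINGS D-0062 ∕ D-0149), WIDTH SEAT `pub-ymgap-dag-n12-w3` g2 (node N12 = [B15]; key K1⁷ `stmt-QuantumFields-20542`, `--kind proof --supports … --as helper`;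
count-neutral).  THEOREMS ONLY (0 `def`, 0 `instance`, 0 `sorry`); every input CONSUMED BY NAME, nothing modified: this seat's null-space theorem
`N12FlatFibreNullSpace.exists_centreGauge_of_plaq_eq_zero_of_iterLin_eq_zero` ∕ `centreGauge_mem`; dag-n10-w1's `N12FlatChartDerivIterLin.fderiv_msChart_one_apply_eq_iterLin`,
`iterLin_mem_lieSU`, `agreeOn_avgFamily_one`, `smallBelow_avOfRecord_one`; dag-n12-w2's `Node00.deriv_deriv_wilsonAction4_expChart_one_eq_norm_sq`; n07-w2's `Node00.msChart`,
`hasStrictFDerivAt_msChart`, `coe_suProj_of_mem`; dag-n12-w3 g0's junction `B11Eq177CriticalFamilyDerivative.deriv_deriv_wilsonAction4_expChart_smul_eq`.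

THE PRINT.  [Balaban1985Variational] (82)–(83) p. 290 (criticality on the fibre, gauge condition `R D*δA′ = 0`), Sect. E p. 300 (positivity of the Hessian on the axial subspace);
[Balaban1989LargeFieldII] (1.9) p. 358 and p. 359 («Denote by P₀ the projection onto the subspace of B′ satisfying the gauge condition B′↾G₀ = 0. By the inequality (1.9) the operator
P₀H*_{1,k}Δ₁H_{1,k}P₀ is positive, hence invertible on this subspace»).  The letter `hnondeg` of dag-n12-w1's `hMin_of_baseFieldLetters` and the binder `hnd` of dag-n12-w3 g0's U2b theorem
`B11Eq177CriticalFamilyDerivative.fderiv_flatCriticalExpChartFamily_eq` both ask, at the flat base field, exactly for the statement of §3 below (dag-n12-w3 g0 LOCATED-1, bus l.25339: at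
`Ψ := msChart` ALONE the binder is false — the kernel contains the pure gauges trivial at the centres; it must be read on a gauge slice).

CONTENTS.
§1 `deriv_deriv_wilsonAction4_expChart_one_eq_zero_iff` — at `U₀ = 1` the second variation along `X` vanishes IFF every plaquette variable of `X` vanishes (a sum of Hilbert–Schmidt
   squares); `coe_plaq_eq_zero_of_deriv_deriv_eq_zero` (matrix form).
§2 `iterLin_eq_zero_of_fderiv_msChart_one_eq_zero` — `DΦ(0)X = 0` for the flat multi-scale chart `Φ = msChart F N K k 𝔹 (M˙1) 1` kills `(Q^{(k)}↑X)(c)` at every level-`k` bond `c`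
   meeting `Γ_k` (`π` is the identity on the `𝔰𝔲(N)`-valued `Q^{(k)}↑X`).
§3 ★★★ `eq_zero_of_fderiv_msChart_one_eq_zero_of_transversal` — for `𝔹` constraining every level-`k` bond and a set `S` of fine fields TRANSVERSAL to the centre-vanishing pure gauges
   (DISPLAYED letter `hS`): `X ∈ S ∧ DΦ(0)X = 0 ∧ d²∕ds²A(e^{sX})|₀ = 0 ⟹ X = 0`; ★★ `hnd_flat_msChart_prod` — the same packaged as the `hnd` binder of the U2b theorem for the gauge-fixed
   chart `Ψ = (Φ, G)`, `G` any continuous linear gauge-fixing map with transversal kernel (only the diagonal `t = d` of the bilinear hypothesis is used).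

HONEST FRAMING.  Flat configuration only (`U₀ = 1`, multiplier `λ₀ = 0`); the constraint must contain all level-`k` bonds (`𝔹 k ⊇ Γ_k = T^{(k)}`, print's whole-lattice `k`-fold
average; extra lower-level constraints only shrink the kernel); the slice ∕ gauge-fixing letter is DISPLAYED, not instantiated (print: the block-axial gauge `B′↾G₀ = 0`, where it is a
telescoping identity); the `honto` letter (surjectivity of `DΨ(0)`, [15] (45)∕(47)) and the near-flat backgrounds `U₀ ≠ 1` are NOT treated; no coercivity constant.  Nothing of Bałaban's
estimates is asserted; N12 NOT discharged; K1⁷ NOT closed; counts unmoved (typed 28∕28 · discharged 5∕27); one finite 𝕋⁴ programme at fixed ε — R4 closes the conditional rung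
`BalabanLadder.UV` only; the Yang–Mills mass gap (Clay) is NOT proved by any of this; nothing continuum ∕ ℝ⁴ ∕ OS.
-/

noncomputable section

open scoped BigOperators Matrix.Norms.L2Operator Topology

namespace Summit.QuantumFields.YangMills.BalabanUVNodes.N12FlatChartHnd

open Literature.MathematicalPhysics.QuantumFieldTheory.Balaban1983to89
open T4Continuum (T4Family)
open BlockAveragingEMLLinearised (linAvg)
open T4AdjointCovarianceUnitary (lieSU)
open B15DeterminingSets
open Node00
open Summit.QuantumFields.YangMills.BalabanUVNodes.N12FlatChartDerivIterLin (fderiv_msChart_one_apply_eq_iterLin iterLin_mem_lieSU)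

/-! ## §1 Null directions of the flat second variation: all plaquette variables vanish -/

section Plaq

variable {P : Params} {j : ℕ} {N : ℕ} [NeZero N]

/-- At the flat configuration, the second variation of the Wilson action along `X` vanishes IFF every plaquette variable of `X` vanishes (w2's
Hilbert–Schmidt formula `Node00.deriv_deriv_wilsonAction4_expChart_one_eq_norm_sq`: a sum of squares over a positive integer). [cite: Balaban1985BackgroundPropagators, (3.10) p.392; Balaban1989LargeFieldII, p.357] -/
theorem deriv_deriv_wilsonAction4_expChart_one_eq_zero_iff (X : PBond P j → lieSU (Fin N)) :
    deriv (deriv fun s : ℝ => wilsonAction4 (expChart (1 : GaugeField P j (SU N)) (s • X))) 0 = 0 ↔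
      ∀ p : Plaq P j, X ⟨p.src, p.μ⟩ + X ⟨p.src.shift p.μ, p.ν⟩ - X ⟨p.src.shift p.ν, p.μ⟩ - X ⟨p.src, p.ν⟩ = 0 := by
  rw [deriv_deriv_wilsonAction4_expChart_one_eq_norm_sq, div_eq_zero_iff]
  have hN : (Fintype.card (Fin N) : ℝ) ≠ 0 := Nat.cast_ne_zero.mpr (Fintype.card_ne_zero)
  simp only [hN, or_false]
  rw [Finset.sum_eq_zero_iff_of_nonneg fun p _ => sq_nonneg _]
  simp only [Finset.mem_univ, forall_const, sq_eq_zero_iff, norm_eq_zero]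


/-- The flat second variation of the Wilson action along any direction is `≥ 0` (a sum of Hilbert–Schmidt squares over `N`). [cite: Balaban1985BackgroundPropagators, (3.10) p.392] -/
theorem deriv_deriv_wilsonAction4_expChart_one_nonneg (X : PBond P j → lieSU (Fin N)) :
    0 ≤ deriv (deriv fun s : ℝ => wilsonAction4 (expChart (1 : GaugeField P j (SU N)) (s • X))) 0 := by
  rw [deriv_deriv_wilsonAction4_expChart_one_eq_norm_sq]
  exact div_nonneg (Finset.sum_nonneg fun p _ => sq_nonneg _) (Nat.cast_nonneg _)

/-- Matrix form of `deriv_deriv_wilsonAction4_expChart_one_eq_zero_iff` (⇒): the plaquette variables of the matrix-valued field `b ↦ ↑X_b` vanish. [cite: Balaban1989LargeFieldII, p.357] -/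
theorem coe_plaq_eq_zero_of_deriv_deriv_eq_zero (X : PBond P j → lieSU (Fin N))
    (h : deriv (deriv fun s : ℝ => wilsonAction4 (expChart (1 : GaugeField P j (SU N)) (s • X))) 0 = 0) (p : Plaq P j) :
    (X ⟨p.src, p.μ⟩ : Matrix (Fin N) (Fin N) ℂ) + (X ⟨p.src.shift p.μ, p.ν⟩ : Matrix (Fin N) (Fin N) ℂ)
      - (X ⟨p.src.shift p.ν, p.μ⟩ : Matrix (Fin N) (Fin N) ℂ) - (X ⟨p.src, p.ν⟩ : Matrix (Fin N) (Fin N) ℂ) = 0 := by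
  have hp := (deriv_deriv_wilsonAction4_expChart_one_eq_zero_iff X).1 h p
  rw [← Submodule.coe_add, ← Submodule.coe_sub, ← Submodule.coe_sub, hp, Submodule.coe_zero]

end Plaq

/-! ## §2 At NODE 00's flat chart: the kernel of `DΦ(0)` kills `Q^{(k)}` on every constrained level-`k` bond -/

section NodeZero

variable {F : T4Family} {N : ℕ} [NeZero N] {K k : ℕ}

/-- If `X` is in the kernel of the derivative at `0` of the flat multi-scale chart `Φ = msChart F N K k 𝔹 (M˙1) 1`, then `(Q^{(k)}↑X)(c) = 0` at every level-`k` bond `c` meeting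
`Γ_k` (n10-w1's `fderiv_msChart_one_apply_eq_iterLin` at the constrained bond `(k, c)`, and `π` is the identity on the `𝔰𝔲(N)`-valued `Q^{(k)}↑X`).
[cite: Balaban1985Variational, (44)-(48) p.285; Balaban1988Convergent, (2.10)-(2.12) p.256] -/
theorem iterLin_eq_zero_of_fderiv_msChart_one_eq_zero
    (Q : (i : ℕ) → (PBond (F.P K) 0 → Matrix (Fin N) (Fin N) ℂ) → PBond (F.P K) i → Matrix (Fin N) (Fin N) ℂ)
    (hQ0 : ∀ Y, Q 0 Y = Y) (hQs : ∀ (i : ℕ) (Y : PBond (F.P K) 0 → Matrix (Fin N) (Fin N) ℂ) (c : PBond (F.P K) (i + 1)), Q (i + 1) Y c = linAvg (Q i Y) c)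
    (𝔹 : DetSet (F.P K)) {X : PBond (F.P K) 0 → lieSU (Fin N)}
    (hker : fderiv ℝ (msChart F N K k 𝔹 (avgFamily (avOfRecord F N K) (1 : GaugeField (F.P K) 0 (SU N))) (1 : GaugeField (F.P K) 0 (SU N))) 0 X = 0)
    {c : PBond (F.P K) k} (hc : c ∈ bondsOf (𝔹 k)) :
    Q k (fun b => (X b : Matrix (Fin N) (Fin N) ℂ)) c = 0 := by
  set i : Fin (constrCard 𝔹 k) := constrEnum 𝔹 k ⟨⟨k, Nat.lt_succ_self k⟩, ⟨c, hc⟩⟩ with hi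
  have h := fderiv_msChart_one_apply_eq_iterLin (F := F) (N := N) (K := K) (k := k) Q hQ0 hQs 𝔹 X i
  rw [hker, hi, Equiv.symm_apply_apply] at h
  have hmem : Q k (fun b => (X b : Matrix (Fin N) (Fin N) ℂ)) c ∈ lieSU (Fin N) := iterLin_mem_lieSU Q hQ0 hQs (fun b => (X b).2) k c
  have h' := congrArg (fun Z : lieSU (Fin N) => (Z : Matrix (Fin N) (Fin N) ℂ)) h
  simp only [Pi.zero_apply, ZeroMemClass.coe_zero] at h'
  rw [coe_suProj_of_mem hmem] at h'
  exact h'.symm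

end NodeZero

/-! ## §3 The nondegeneracy letter at NODE 00's flat multi-scale chart, modulo the slice letter -/

section Hnd

variable {F : T4Family} {N : ℕ} [NeZero N] {K k : ℕ}

open Summit.QuantumFields.YangMills.BalabanUVNodes.N12FlatFibreNullSpace
  (exists_centreGauge_of_plaq_eq_zero_of_iterLin_eq_zero centreGauge_mem)

/-- ★★★ **`hnd` AT THE FLAT CONFIGURATION OF NODE 00, MODULO THE SLICE LETTER.**  Let `𝔹` constrain every level-`k` bond (print's `k`-fold average on the whole lattice,
`atScale k`; further constraints of lower levels only shrink the kernel).  If a set `S` of fine `𝔰𝔲(N)`-fields is TRANSVERSAL to the centre-vanishing pure gauges (`hS`, DISPLAYED: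
the only `dφ ∈ S` with `φ = 0` at the `k`-fold centres is `0` — print's block-axial gauge), then every `X ∈ S` in the kernel of the derivative at `0` of the flat multi-scale chart
`Φ = msChart F N K k 𝔹 (M˙1) 1` along which the flat second variation of the Wilson action vanishes is `X = 0`.  ROUTE: `DΦ(0)X = 0` ⟹ `Q^{(k)}↑X = 0` on every level-`k` bond (§2,
dag-n10-w1); `d²∕ds² A(e^{sX})|₀ = 0` ⟹ all plaquette variables of `X` vanish (§1, dag-n12-w2); the null-space theorem `N12FlatFibreNullSpace.exists_centreGauge_of_plaq_eq_zero_of_iterLin_eq_zero`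
⟹ `X = dφ`, `φ|_{centres} = 0`, `φ` `𝔰𝔲(N)`-valued; the slice letter ⟹ `X = 0`. [cite: Balaban1989LargeFieldII, (1.9) p.358, p.359; Balaban1985Variational, (4) p.278, Sect. E p.300] -/
theorem eq_zero_of_fderiv_msChart_one_eq_zero_of_transversal (𝔹 : DetSet (F.P K)) (h𝔹 : ∀ c : PBond (F.P K) k, c ∈ bondsOf (𝔹 k))
    {S : Set (PBond (F.P K) 0 → lieSU (Fin N))}
    (hS : ∀ φ : Site (F.P K) 0 → lieSU (Fin N), (∀ y : Site (F.P K) k, φ (embIter k y) = 0) →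
      (fun b : PBond (F.P K) 0 => φ b.tgt - φ b.src) ∈ S → ∀ b : PBond (F.P K) 0, φ b.tgt - φ b.src = 0)
    {X : PBond (F.P K) 0 → lieSU (Fin N)} (hXS : X ∈ S)
    (hker : fderiv ℝ (msChart F N K k 𝔹 (avgFamily (avOfRecord F N K) (1 : GaugeField (F.P K) 0 (SU N))) (1 : GaugeField (F.P K) 0 (SU N))) 0 X = 0)
    (hflat : deriv (deriv fun s : ℝ => wilsonAction4 (expChart (1 : GaugeField (F.P K) 0 (SU N)) (s • X))) 0 = 0) :
    X = 0 := by
  -- a recursion family of the linearised average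
  obtain ⟨Q, hQ0, hQs⟩ : ∃ Q : (i : ℕ) → (PBond (F.P K) 0 → Matrix (Fin N) (Fin N) ℂ) → PBond (F.P K) i → Matrix (Fin N) (Fin N) ℂ,
      (∀ Y, Q 0 Y = Y) ∧ ∀ (i : ℕ) (Y : PBond (F.P K) 0 → Matrix (Fin N) (Fin N) ℂ) (c : PBond (F.P K) (i + 1)), Q (i + 1) Y c = linAvg (Q i Y) c :=
    ⟨fun i => Nat.rec (motive := fun i => (PBond (F.P K) 0 → Matrix (Fin N) (Fin N) ℂ) → PBond (F.P K) i → Matrix (Fin N) (Fin N) ℂ) (fun Y => Y)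
      (fun _ Qi Y c => linAvg (Qi Y) c) i, fun _ => rfl, fun _ _ _ => rfl⟩
  have hQ : ∀ c : PBond (F.P K) k, Q k (fun b => (X b : Matrix (Fin N) (Fin N) ℂ)) c = 0 := fun c =>
    iterLin_eq_zero_of_fderiv_msChart_one_eq_zero Q hQ0 hQs 𝔹 hker (h𝔹 c)
  have hcurl := coe_plaq_eq_zero_of_deriv_deriv_eq_zero X hflat
  obtain ⟨φ₀, hφ₀, hXφ₀⟩ := exists_centreGauge_of_plaq_eq_zero_of_iterLin_eq_zero Q hQ0 hQs k (fun b => (X b : Matrix (Fin N) (Fin N) ℂ)) hcurl hQ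
  have hmem : ∀ x, φ₀ x ∈ lieSU (Fin N) := fun x =>
    centreGauge_mem (lieSU (Fin N)).toAddSubgroup (X := fun b => (X b : Matrix (Fin N) (Fin N) ℂ)) (fun b => (X b).2) hφ₀ hXφ₀ x
  set φ : Site (F.P K) 0 → lieSU (Fin N) := fun x => ⟨φ₀ x, hmem x⟩ with hφdef
  have hφ : ∀ y : Site (F.P K) k, φ (embIter k y) = 0 := fun y => Subtype.ext (hφ₀ y)
  have hXφ : (fun b : PBond (F.P K) 0 => φ b.tgt - φ b.src) = X :=
    funext fun b => Subtype.ext (by rw [Submodule.coe_sub, hXφ₀ b])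
  have h0 := hS φ hφ (hXφ ▸ hXS)
  funext b
  have hb : X b = φ b.tgt - φ b.src := (congrFun hXφ b).symm
  rw [hb, Pi.zero_apply]
  exact h0 b


/-- ★★ **POSITIVITY FORM** (the shape dag-n12-w1's `real_nondegenerate_of_pos` consumes): on a transversal slice, every NONZERO direction in the kernel of the flat multi-scale chart's
derivative has STRICTLY POSITIVE flat second variation `d²∕ds² A(e^{sX})|₀ > 0` (nonnegativity §1 + the vanishing theorem). [cite: Balaban1989LargeFieldII, (1.9) p.358, p.359; Balaban1985Variational, Sect. E p.300] -/
theorem deriv_deriv_pos_of_fderiv_msChart_one_eq_zero_of_transversal (𝔹 : DetSet (F.P K)) (h𝔹 : ∀ c : PBond (F.P K) k, c ∈ bondsOf (𝔹 k))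
    {S : Set (PBond (F.P K) 0 → lieSU (Fin N))}
    (hS : ∀ φ : Site (F.P K) 0 → lieSU (Fin N), (∀ y : Site (F.P K) k, φ (embIter k y) = 0) →
      (fun b : PBond (F.P K) 0 => φ b.tgt - φ b.src) ∈ S → ∀ b : PBond (F.P K) 0, φ b.tgt - φ b.src = 0)
    {X : PBond (F.P K) 0 → lieSU (Fin N)} (hXS : X ∈ S) (hX0 : X ≠ 0)
    (hker : fderiv ℝ (msChart F N K k 𝔹 (avgFamily (avOfRecord F N K) (1 : GaugeField (F.P K) 0 (SU N))) (1 : GaugeField (F.P K) 0 (SU N))) 0 X = 0) :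
    0 < deriv (deriv fun s : ℝ => wilsonAction4 (expChart (1 : GaugeField (F.P K) 0 (SU N)) (s • X))) 0 :=
  lt_of_le_of_ne (deriv_deriv_wilsonAction4_expChart_one_nonneg X) fun h =>
    hX0 (eq_zero_of_fderiv_msChart_one_eq_zero_of_transversal 𝔹 h𝔹 hS hXS hker h.symm)

/-- ★★ **THE `hnd` BINDER OF THE U2b THEOREM, DISCHARGED FOR THE GAUGE-FIXED FLAT MULTI-SCALE CHART `X ↦ (Φ X, G X)`** (dag-n12-w3 g0's LOCATED-1: «instantiate `Ψ := (msChart, gauge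
condition)` — never `msChart` alone»): for every continuous linear gauge-fixing map `G` whose kernel is transversal to the centre-vanishing pure gauges (`hG`, DISPLAYED) and every `𝔹`
constraining all level-`k` bonds, the binder `hnd` of `B11Eq177CriticalFamilyDerivative.fderiv_flatCriticalExpChartFamily_eq` holds for `Ψ := fun X => (msChart … (M˙1) 1 X, G X)`:
`DΨ(0)d = 0` and `D²(A∘expChart 1)(0)(d, ·) = 0` on `ker DΨ(0)` force `d = 0` (only the diagonal `t = d` is used). [cite: Balaban1989LargeFieldII, (1.9) p.358, p.359; Balaban1985Variational, (83) p.290, Sect. E p.300] -/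
theorem hnd_flat_msChart_prod (𝔹 : DetSet (F.P K)) (h𝔹 : ∀ c : PBond (F.P K) k, c ∈ bondsOf (𝔹 k))
    {W : Type*} [NormedAddCommGroup W] [NormedSpace ℝ W] (G : (PBond (F.P K) 0 → lieSU (Fin N)) →L[ℝ] W)
    (hG : ∀ φ : Site (F.P K) 0 → lieSU (Fin N), (∀ y : Site (F.P K) k, φ (embIter k y) = 0) →
      G (fun b : PBond (F.P K) 0 => φ b.tgt - φ b.src) = 0 → ∀ b : PBond (F.P K) 0, φ b.tgt - φ b.src = 0)
    (d : PBond (F.P K) 0 → lieSU (Fin N))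
    (hd : fderiv ℝ (fun X => (msChart F N K k 𝔹 (avgFamily (avOfRecord F N K) (1 : GaugeField (F.P K) 0 (SU N))) (1 : GaugeField (F.P K) 0 (SU N)) X, G X)) 0 d = 0)
    (hq : ∀ t, fderiv ℝ (fun X => (msChart F N K k 𝔹 (avgFamily (avOfRecord F N K) (1 : GaugeField (F.P K) 0 (SU N))) (1 : GaugeField (F.P K) 0 (SU N)) X, G X)) 0 t = 0 →
      fderiv ℝ (fun Y => fderiv ℝ (fun Y : PBond (F.P K) 0 → lieSU (Fin N) =>
        wilsonAction4 (expChart (1 : GaugeField (F.P K) 0 (SU N)) Y)) Y) 0 d t = 0) :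
    d = 0 := by
  have hdiff : DifferentiableAt ℝ (msChart F N K k 𝔹 (avgFamily (avOfRecord F N K) (1 : GaugeField (F.P K) 0 (SU N))) (1 : GaugeField (F.P K) 0 (SU N))) 0 :=
    (hasStrictFDerivAt_msChart (N12FlatChartDerivIterLin.agreeOn_avgFamily_one 𝔹) N12FlatChartDerivIterLin.smallBelow_avOfRecord_one).hasFDerivAt.differentiableAt
  have H : HasFDerivAt
      (fun X => (msChart F N K k 𝔹 (avgFamily (avOfRecord F N K) (1 : GaugeField (F.P K) 0 (SU N))) (1 : GaugeField (F.P K) 0 (SU N)) X, G X))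
      ((fderiv ℝ (msChart F N K k 𝔹 (avgFamily (avOfRecord F N K) (1 : GaugeField (F.P K) 0 (SU N))) (1 : GaugeField (F.P K) 0 (SU N))) 0).prod G) 0 :=
    hdiff.hasFDerivAt.prodMk G.hasFDerivAt
  have hprod : ∀ t : PBond (F.P K) 0 → lieSU (Fin N),
      fderiv ℝ (fun X => (msChart F N K k 𝔹 (avgFamily (avOfRecord F N K) (1 : GaugeField (F.P K) 0 (SU N))) (1 : GaugeField (F.P K) 0 (SU N)) X, G X)) 0 t
        = (fderiv ℝ (msChart F N K k 𝔹 (avgFamily (avOfRecord F N K) (1 : GaugeField (F.P K) 0 (SU N))) (1 : GaugeField (F.P K) 0 (SU N))) 0 t, G t) := fun t => by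
    rw [H.fderiv]
    rfl
  have hd' := hd
  rw [hprod, Prod.mk_eq_zero] at hd'
  have hflat : deriv (deriv fun s : ℝ => wilsonAction4 (expChart (1 : GaugeField (F.P K) 0 (SU N)) (s • d))) 0 = 0 := by
    rw [B11Eq177CriticalFamilyDerivative.deriv_deriv_wilsonAction4_expChart_smul_eq]
    exact hq d hd
  exact eq_zero_of_fderiv_msChart_one_eq_zero_of_transversal 𝔹 h𝔹 (S := {X | G X = 0})
    (fun φ hφ hGφ => hG φ hφ hGφ) hd'.2 hd'.1 hflat

end Hnd

end Summit.QuantumFields.YangMills.BalabanUVNodes.N12FlatChartHnd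

end
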